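import Summits.CriticalPhenomena.PercolationContinuityZ3.Theorems.PercNearOneGluingNoHeavyLowerTailFourCopyHubTriB
import HarnessLib

/-! — part 3: soundness at the real states (regrouping and per-program bounds)
# `NoHeavyLowerTail` (stmt-CriticalPhenomena-4575) — FOUR-copy switching certificates, VIII: the TRIANGLE bound
# (two-step programs on all pairs of target copies), its soundness, and the `E₃` conclusion from a computed bound

Support file (prover prim-ineq-prove-3 gen 8; `--supports stmt-CriticalPhenomena-4575`).  No named facts, no sorries.

The certificates of gen 6 (referee-verified for all finite graphs in the compute lane) use ALL 72 two-step programs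
`u → T₁ ; v → T₂` (`{T₁,T₂} ⊆ {1,2,3}`), including those with target set `{1,2}`, which couple the two side copies.  For a
weakly well-formed certificate `c` (`Cert.wfT`: no hub condition) the bound of this file is
`VT c πX t₁ t₂ t₃ = max over the refined states s₁ of copy 1 and s₃ of copy 3 of F(s₁,s₃) + Σ_w max_{p ∈ opts(t₂,w)} G_w(p; s₁,s₃)`:
given `s₁` and `s₃`, copy `2` and its `X`-blocks decouple (every program reads at most one root letter of copy `2`).  The
per-source-type tables (`mkTriTabs`) are plain integer tables of `e1`/`e2` (no packing: this bound is meant to be EVALUATED —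
`decide` by compiled evaluation — not reduced by the kernel; ≈ 10⁹ elementary operations for the full certificate).
SOUNDNESS (`Sreal_le_VT`): `Sreal c τ x ≤ VT c (type x₀) (type x₁) (type x₂) (type x₃)`.
CONCLUSION (`e3_nonneg_of_triOK`): if `triOK c E D = true` — the symmetrisation of the cell function
`U = Pc + D·Tc − V` is nonnegative at every sorted cell, `V` the table of all `VT` values — then `E₃(A,B,C) ≥ 0` for the
target events on every finite graph (measure preservation `E[S] = E[Pc]`, `S ≤ V(code)`, `E[U(code)] ≥ 0`).
-/

namespace Summit.CriticalPhenomena.PercolationContinuityZ3.Theorems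

namespace FourCopyHub

open Finset Literature.Probability.Percolation Literature.Probability.Percolation.DecisionTree
open Literature.Probability.Percolation.Gladkov ThreePointLB GroupThreePointLB FourPointAtoms SwitchRelax SwitchingK
open scoped Classical

/-! ### Soundness: the real value is dominated by the specification value at the real states -/

/-- Class indices are in range. [this work] -/
def Cert.clsOK (c : Cert) : Bool := allTys.all fun t => decide (c.cls t < c.ncls) && decide (c.cls2 t < c.ncl2)

section Real

variable {V : Type*} [Fintype V] [DecidableEq V] (τ : Fin 4 → V) {c : Cert} (x : Fin 4 → Finset (Sym2 V))

/-- Auxiliary lemma `cls_lt_nA` (see the statement). [this work] -/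
theorem cls_lt_nA (h : c.clsOK = true) (t : Ty) : c.cls t < c.nA := by
  simp only [Cert.clsOK, List.all_eq_true, Bool.and_eq_true, decide_eq_true_iff] at h
  exact lt_of_lt_of_le (h t (mem_allTys t)).1 (le_max_left _ _)

/-- Auxiliary lemma `cls2_lt_nA` (see the statement). [this work] -/
theorem cls2_lt_nA (h : c.clsOK = true) (t : Ty) : c.cls2 t < c.nA := by
  simp only [Cert.clsOK, List.all_eq_true, Bool.and_eq_true, decide_eq_true_iff] at h
  exact lt_of_lt_of_le (h t (mem_allTys t)).2 (le_max_right _ _)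

/-- Idle copies of the six kinds of two-step programs. [this work] -/
theorem P2.idl_of {q : P2} {a b : Fin 4} (ha : q.T1 = a) (hb : q.T2 = b) :
    q.idl = (if a ≠ 1 ∧ b ≠ 1 then 1 else if a ≠ 2 ∧ b ≠ 2 then 2 else 3) := by
  rw [P2.idl, ha, hb]

/-- Termwise bounds add up. [folklore] -/
theorem sum_map_le {α : Type} (L : List α) (f g : α → ℤ) (h : ∀ a ∈ L, f a ≤ g a) : (L.map f).sum ≤ (L.map g).sum :=
  List.sum_le_sum h

/-- Sum over `List.finRange 4` of filtered sums = sum filtered by a `Fin 4`-valued key. [this work] -/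
theorem sum_key4' {α : Type} (L : List α) (key : α → Fin 4) (f : α → ℤ) :
    (L.map f).sum = ((List.finRange 4).map fun k => ((L.filter fun a => key a = k).map f).sum).sum := by
  rw [sum_map_finRange4, sum_key4 L key f]

/-- **SOUNDNESS (pointwise).**  For a weakly well-formed certificate with class indices in range, the real value is
at most the specification value at the real projected states of the three target copies. [this work] -/
theorem Sreal_le_specVal (hw : c.wfT = true) (hcl : c.clsOK = true) :
    Sreal τ c x ≤ specVal c (mkTriTabs c (ftype τ (x 0))) (ftype τ (x 1)) (ftype τ (x 2)) (ftype τ (x 3))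
      (st τ x 3) (st τ x 1) (st τ x 2) := by
  set πX := ftype τ (x 0) with hπX
  set t1 := ftype τ (x 1) with ht1
  set t2 := ftype τ (x 2) with ht2
  set t3 := ftype τ (x 3) with ht3
  set s1 := st τ x 1 with hs1
  set s2 := st τ x 2 with hs2
  set s3 := st τ x 3 with hs3
  set P := mkTriTabs c πX with hP
  have hA := cls2_lt_nA hcl
  have hC := cls_lt_nA hcl
  have wf1 : ∀ q ∈ c.one, q.wf = true := by
    simp only [Cert.wfT, Bool.and_eq_true, List.all_eq_true] at hw; exact hw.1
  have wf2 : ∀ q ∈ c.two, q.wfT = true := by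
    simp only [Cert.wfT, Bool.and_eq_true, List.all_eq_true] at hw; exact hw.2
  have T0 : ∀ q ∈ c.one, q.T ≠ 0 := fun q hq => by
    have h := wf1 q hq; rw [P1.wf, decide_eq_true_iff] at h; exact h
  have TT : ∀ q ∈ c.two, q.T1 ≠ 0 ∧ q.T2 ≠ 0 ∧ q.T2 ≠ q.T1 := fun q hq => by
    have h := wf2 q hq; rw [P2.wfT, decide_eq_true_iff] at h; exact h
  -- membership in filtered lists
  have memf : ∀ {α : Type} (L : List α) (Q : α → Prop) [DecidablePred Q] (a : α), a ∈ L.filter (fun b => Q b) → a ∈ L ∧ Q a :=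
    fun L Q _ a h => by have h' := List.mem_filter.1 h; exact ⟨h'.1, by simpa using h'.2⟩
  -- ONE-STEP PROGRAMS
  have one_eq : (c.one.map fun q => q.val τ c x).sum =
      ((c.one.filter fun q => q.T = 3).map fun q => q.val τ c x).sum
      + ((List.finRange 4).map fun u => ((c.one.filter fun q => q.T = 1 ∧ rep πX q.u = u).map fun q => q.val τ c x).sum).sum
      + ((List.finRange 4).map fun w => ((c.one.filter fun q => q.T = 2 ∧ rep πX q.u = w).map fun q => q.val τ c x).sum).sum := by
    rw [sum_key4 c.one (fun q => q.T), sum_filter_eq_zero _ _ _ (fun q hq => T0 q hq),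
      sum_key4' (c.one.filter fun q => q.T = 1) (fun q => rep πX q.u),
      sum_key4' (c.one.filter fun q => q.T = 2) (fun q => rep πX q.u)]
    simp only [filter_and]; ring
  have b3 : ((c.one.filter fun q => q.T = 3).map fun q => q.val τ c x).sum ≤ triF0 c P t1 t2 s3 := by
    rw [triF0, hP, o3_eq, List.map_map]
    refine sum_map_le _ _ _ fun q hq => ?_
    obtain ⟨hq1, hT⟩ := memf _ _ q hq
    have hv := P1.val_le τ c x (wf1 q hq1)
    rw [hT, if_pos rfl, if_pos rfl] at hv
    show q.val τ c x ≤ lk3 (tab1 c (CTab c πX) q) (s3 (rep πX q.u)) (c.cls t1) (c.cls t2)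
    rw [lk3_tab1 c πX q _ (hC t1) (hC t2)]; exact hv
  have b1 : ∀ u : Fin 4, ((c.one.filter fun q => q.T = 1 ∧ rep πX q.u = u).map fun q => q.val τ c x).sum ≤
      ((lk P.o1 u.val []).map fun T => lk3 T (s1 u) (c.cls2 t2) (c.cls t3)).sum := fun u => by
    rw [hP, o1_eq, List.map_map]
    refine sum_map_le _ _ _ fun q hq => ?_
    obtain ⟨hq1, hT, hu⟩ := memf _ _ q hq
    have hv := P1.val_le τ c x (wf1 q hq1)
    have o12 : oth 1 = 2 := by decide
    rw [hT, if_neg (by decide), if_neg (by decide), o12, hu] at hv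
    show q.val τ c x ≤ lk3 (tab1 c (CTab c πX) q) (s1 u) (c.cls2 t2) (c.cls t3)
    rw [lk3_tab1 c πX q _ (hA t2) (hC t3)]; exact hv
  have b2 : ∀ w : Fin 4, ((c.one.filter fun q => q.T = 2 ∧ rep πX q.u = w).map fun q => q.val τ c x).sum ≤
      ((lk P.o2 w.val []).map fun T => lk3 T (s2 w) (c.cls2 t1) (c.cls t3)).sum := fun w => by
    rw [hP, o2_eq, List.map_map]
    refine sum_map_le _ _ _ fun q hq => ?_
    obtain ⟨hq1, hT, hu⟩ := memf _ _ q hq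
    have hv := P1.val_le τ c x (wf1 q hq1)
    have o21 : oth 2 = 1 := by decide
    rw [hT, if_neg (by decide), if_neg (by decide), o21, hu] at hv
    show q.val τ c x ≤ lk3 (tab1 c (CTab c πX) q) (s2 w) (c.cls2 t1) (c.cls t3)
    rw [lk3_tab1 c πX q _ (hA t1) (hC t3)]; exact hv
  -- TWO-STEP PROGRAMS: split by (T1, T2) then by letters
  have two_eq : (c.two.map fun q => q.val τ c x).sum =
      ((List.finRange 4).map fun u => ((c.two.filter fun q => q.T1 = 1 ∧ q.T2 = 3 ∧ rep πX q.u = u).map fun q => q.val τ c x).sum).sum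
    + ((List.finRange 4).map fun u => ((c.two.filter fun q => q.T1 = 3 ∧ q.T2 = 1 ∧ rep πX q.v = u).map fun q => q.val τ c x).sum).sum
    + ((List.finRange 4).map fun w => ((c.two.filter fun q => q.T1 = 2 ∧ q.T2 = 3 ∧ rep πX q.u = w).map fun q => q.val τ c x).sum).sum
    + ((List.finRange 4).map fun w => ((c.two.filter fun q => q.T1 = 3 ∧ q.T2 = 2 ∧ rep πX q.v = w).map fun q => q.val τ c x).sum).sum
    + ((List.finRange 4).map fun w => ((List.finRange 4).map fun u =>
        ((c.two.filter fun q => q.T1 = 1 ∧ q.T2 = 2 ∧ rep πX q.u = u ∧ rep πX q.v = w).map fun q => q.val τ c x).sum).sum).sum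
    + ((List.finRange 4).map fun w => ((List.finRange 4).map fun u =>
        ((c.two.filter fun q => q.T1 = 2 ∧ q.T2 = 1 ∧ rep πX q.u = w ∧ rep πX q.v = u).map fun q => q.val τ c x).sum).sum).sum := by
    have z : ∀ (a : Fin 4), (((c.two.filter fun q => q.T1 = a).filter fun q => q.T2 = a).map fun q => q.val τ c x).sum = 0 :=
      fun a => sum_filter_eq_zero _ _ _ fun q hq => by
        obtain ⟨hq2, ha⟩ := memf _ _ q hq; exact fun h => (TT q hq2).2.2 (h.trans ha.symm)
    have z0 : ∀ (a : Fin 4), (((c.two.filter fun q => q.T1 = a).filter fun q => q.T2 = 0).map fun q => q.val τ c x).sum = 0 :=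
      fun a => sum_filter_eq_zero _ _ _ fun q hq => (TT q (memf _ _ q hq).1).2.1
    rw [sum_key4 c.two (fun q => q.T1), sum_filter_eq_zero _ _ _ (fun q hq => (TT q hq).1),
      sum_key4 (c.two.filter fun q => q.T1 = 1) (fun q => q.T2), z0, z,
      sum_key4 (c.two.filter fun q => q.T1 = 2) (fun q => q.T2), z0, z,
      sum_key4 (c.two.filter fun q => q.T1 = 3) (fun q => q.T2), z0, z,
      sum_key4' ((c.two.filter fun q => q.T1 = 1).filter fun q => q.T2 = 3) (fun q => rep πX q.u),
      sum_key4' ((c.two.filter fun q => q.T1 = 3).filter fun q => q.T2 = 1) (fun q => rep πX q.v),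
      sum_key4' ((c.two.filter fun q => q.T1 = 2).filter fun q => q.T2 = 3) (fun q => rep πX q.u),
      sum_key4' ((c.two.filter fun q => q.T1 = 3).filter fun q => q.T2 = 2) (fun q => rep πX q.v),
      sum_key4' ((c.two.filter fun q => q.T1 = 1).filter fun q => q.T2 = 2) (fun q => rep πX q.v),
      sum_key4' ((c.two.filter fun q => q.T1 = 2).filter fun q => q.T2 = 1) (fun q => rep πX q.u)]
    have e12 : ∀ w : Fin 4, ((((c.two.filter fun q => q.T1 = 1).filter fun q => q.T2 = 2).filter fun q => rep πX q.v = w).map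
        fun q => q.val τ c x).sum = ((List.finRange 4).map fun u =>
        ((c.two.filter fun q => q.T1 = 1 ∧ q.T2 = 2 ∧ rep πX q.u = u ∧ rep πX q.v = w).map fun q => q.val τ c x).sum).sum :=
      fun w => by
        rw [sum_key4' (((c.two.filter fun q => q.T1 = 1).filter fun q => q.T2 = 2).filter fun q => rep πX q.v = w)
          (fun q => rep πX q.u)]
        refine congrArg List.sum (List.map_congr_left fun u _ => congrArg List.sum (congrArg (List.map _) ?_))
        simp only [filter_and, List.filter_filter]
        exact List.filter_congr fun q _ => by simp only [Bool.and_assoc, Bool.decide_and, Bool.and_comm, Bool.and_left_comm]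
    have e21 : ∀ w : Fin 4, ((((c.two.filter fun q => q.T1 = 2).filter fun q => q.T2 = 1).filter fun q => rep πX q.u = w).map
        fun q => q.val τ c x).sum = ((List.finRange 4).map fun u =>
        ((c.two.filter fun q => q.T1 = 2 ∧ q.T2 = 1 ∧ rep πX q.u = w ∧ rep πX q.v = u).map fun q => q.val τ c x).sum).sum :=
      fun w => by
        rw [sum_key4' (((c.two.filter fun q => q.T1 = 2).filter fun q => q.T2 = 1).filter fun q => rep πX q.u = w)
          (fun q => rep πX q.v)]
        refine congrArg List.sum (List.map_congr_left fun u _ => congrArg List.sum (congrArg (List.map _) ?_))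
        simp only [filter_and, List.filter_filter]
        exact List.filter_congr fun q _ => by simp only [Bool.and_assoc, Bool.decide_and, Bool.and_comm, Bool.and_left_comm]
    simp only [filter_and, e12, e21]
    simp only [filter_and] at e12 e21
    ring
  have b13 : ∀ u : Fin 4, ((c.two.filter fun q => q.T1 = 1 ∧ q.T2 = 3 ∧ rep πX q.u = u).map fun q => q.val τ c x).sum ≤
      ((lk P.p13 u.val []).map fun e => lk4 e.1 (s1 u) t3 (s3 e.2) (c.cls2 t2)).sum := fun u => by
    rw [hP, p13_eq, List.map_map]
    refine sum_map_le _ _ _ fun q hq => ?_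
    obtain ⟨hq2, hT1, hT2, hu⟩ := memf _ _ q hq
    have hv := P2.val_le τ c x (wf2 q hq2)
    have hrel := relB_st τ x 3 q.v
    rw [P2.idl_of hT1 hT2] at hv; rw [hT1, hT2, hu] at hv
    show q.val τ c x ≤ lk4 (tab2 c (CTab c πX) (MTab c πX) q) (s1 u) t3 (s3 (rep πX q.v)) (c.cls2 t2)
    rw [lk4_tab2 c πX q _ _ _ (hA t2) hrel]; exact hv
  have b31 : ∀ u : Fin 4, ((c.two.filter fun q => q.T1 = 3 ∧ q.T2 = 1 ∧ rep πX q.v = u).map fun q => q.val τ c x).sum ≤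
      ((lk P.p31 u.val []).map fun e => lk4 e.1 (s3 e.2) t1 (s1 u) (c.cls2 t2)).sum := fun u => by
    rw [hP, p31_eq, List.map_map]
    refine sum_map_le _ _ _ fun q hq => ?_
    obtain ⟨hq2, hT1, hT2, hu⟩ := memf _ _ q hq
    have hv := P2.val_le τ c x (wf2 q hq2)
    have hrel := relB_st τ x 1 q.v
    rw [P2.idl_of hT1 hT2] at hv; rw [hT1, hT2] at hv
    rw [hu] at hv hrel
    show q.val τ c x ≤ lk4 (tab2 c (CTab c πX) (MTab c πX) q) (s3 (rep πX q.u)) t1 (s1 u) (c.cls2 t2)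
    rw [lk4_tab2 c πX q _ _ _ (hA t2) hrel]; exact hv
  have b23 : ∀ w : Fin 4, ((c.two.filter fun q => q.T1 = 2 ∧ q.T2 = 3 ∧ rep πX q.u = w).map fun q => q.val τ c x).sum ≤
      ((lk P.p23 w.val []).map fun e => lk4 e.1 (s2 w) t3 (s3 e.2) (c.cls2 t1)).sum := fun w => by
    rw [hP, p23_eq, List.map_map]
    refine sum_map_le _ _ _ fun q hq => ?_
    obtain ⟨hq2, hT1, hT2, hu⟩ := memf _ _ q hq
    have hv := P2.val_le τ c x (wf2 q hq2)
    have hrel := relB_st τ x 3 q.v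
    rw [P2.idl_of hT1 hT2] at hv; rw [hT1, hT2, hu] at hv
    show q.val τ c x ≤ lk4 (tab2 c (CTab c πX) (MTab c πX) q) (s2 w) t3 (s3 (rep πX q.v)) (c.cls2 t1)
    rw [lk4_tab2 c πX q _ _ _ (hA t1) hrel]; exact hv
  have b32 : ∀ w : Fin 4, ((c.two.filter fun q => q.T1 = 3 ∧ q.T2 = 2 ∧ rep πX q.v = w).map fun q => q.val τ c x).sum ≤
      ((lk P.p32 w.val []).map fun e => lk4 e.1 (s3 e.2) t2 (s2 w) (c.cls2 t1)).sum := fun w => by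
    rw [hP, p32_eq, List.map_map]
    refine sum_map_le _ _ _ fun q hq => ?_
    obtain ⟨hq2, hT1, hT2, hu⟩ := memf _ _ q hq
    have hv := P2.val_le τ c x (wf2 q hq2)
    have hrel := relB_st τ x 2 q.v
    rw [P2.idl_of hT1 hT2] at hv; rw [hT1, hT2] at hv
    rw [hu] at hv hrel
    show q.val τ c x ≤ lk4 (tab2 c (CTab c πX) (MTab c πX) q) (s3 (rep πX q.u)) t2 (s2 w) (c.cls2 t1)
    rw [lk4_tab2 c πX q _ _ _ (hA t1) hrel]; exact hv
  have b12 : ∀ w u : Fin 4, ((c.two.filter fun q => q.T1 = 1 ∧ q.T2 = 2 ∧ rep πX q.u = u ∧ rep πX q.v = w).map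
      fun q => q.val τ c x).sum ≤ ((lk (lk P.p12 u.val []) w.val []).map fun T => lk4 T (s1 u) t2 (s2 w) (c.cls2 t3)).sum :=
    fun w u => by
    rw [hP, p12_eq, List.map_map]
    refine sum_map_le _ _ _ fun q hq => ?_
    obtain ⟨hq2, hT1, hT2, hu, hvw⟩ := memf _ _ q hq
    have hv := P2.val_le τ c x (wf2 q hq2)
    have hrel := relB_st τ x 2 q.v
    rw [P2.idl_of hT1 hT2] at hv; rw [hT1, hT2, hu] at hv
    rw [hvw] at hv hrel
    show q.val τ c x ≤ lk4 (tab2 c (CTab c πX) (MTab c πX) q) (s1 u) t2 (s2 w) (c.cls2 t3)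
    rw [lk4_tab2 c πX q _ _ _ (hA t3) hrel]; exact hv
  have b21 : ∀ w u : Fin 4, ((c.two.filter fun q => q.T1 = 2 ∧ q.T2 = 1 ∧ rep πX q.u = w ∧ rep πX q.v = u).map
      fun q => q.val τ c x).sum ≤ ((lk (lk P.p21 w.val []) u.val []).map fun T => lk4 T (s2 w) t1 (s1 u) (c.cls2 t3)).sum :=
    fun w u => by
    rw [hP, p21_eq, List.map_map]
    refine sum_map_le _ _ _ fun q hq => ?_
    obtain ⟨hq2, hT1, hT2, hu, hvw⟩ := memf _ _ q hq
    have hv := P2.val_le τ c x (wf2 q hq2)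
    have hrel := relB_st τ x 1 q.v
    rw [P2.idl_of hT1 hT2] at hv; rw [hT1, hT2, hu] at hv
    rw [hvw] at hv hrel
    show q.val τ c x ≤ lk4 (tab2 c (CTab c πX) (MTab c πX) q) (s2 w) t1 (s1 u) (c.cls2 t3)
    rw [lk4_tab2 c πX q _ _ _ (hA t3) hrel]; exact hv
  -- assemble
  rw [Sreal, one_eq, two_eq, specVal]
  simp only [triA, triG0, triH, sum_map_finRange4] at b1 b2 b13 b31 b23 b32 b12 b21 ⊢
  have := b1 0; have := b1 1; have := b1 2; have := b1 3
  have := b2 0; have := b2 1; have := b2 2; have := b2 3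
  have := b13 0; have := b13 1; have := b13 2; have := b13 3
  have := b31 0; have := b31 1; have := b31 2; have := b31 3
  have := b23 0; have := b23 1; have := b23 2; have := b23 3
  have := b32 0; have := b32 1; have := b32 2; have := b32 3
  have := b12 0 0; have := b12 0 1; have := b12 0 2; have := b12 0 3
  have := b12 1 0; have := b12 1 1; have := b12 1 2; have := b12 1 3
  have := b12 2 0; have := b12 2 1; have := b12 2 2; have := b12 2 3
  have := b12 3 0; have := b12 3 1; have := b12 3 2; have := b12 3 3
  have := b21 0 0; have := b21 0 1; have := b21 0 2; have := b21 0 3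
  have := b21 1 0; have := b21 1 1; have := b21 1 2; have := b21 1 3
  have := b21 2 0; have := b21 2 1; have := b21 2 2; have := b21 2 3
  have := b21 3 0; have := b21 3 1; have := b21 3 2; have := b21 3 3
  linarith

end Real

end FourCopyHub

end Summit.CriticalPhenomena.PercolationContinuityZ3.Theorems
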